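import Summits.ValiantsHypothesis.ValiantsHypothesis.Theorems.KPlusLogSqLawTropicalShiftDiamondChain

/-!
# Route «KPlusLogSqLaw», crux `TropicalB` (stmt-ValiantsHypothesis-19771) — the two-row single-gauge ceiling `4K − 8` is ATTAINED:
# DIAMOND's chain is certified by one generic affine row gauge

HONEST FRAMING.  Helper `--supports` the crux `Summit.ValiantsHypothesis.ValiantsHypothesis.Theses.KPlusLogSqLaw.TropicalB` (item
stmt-ValiantsHypothesis-19771, route KPlusLogSqLaw, DRAFT; cell `pub-symmetroid`, seat val-sym-trop-p4 g13, 2026-08-28).  Companion of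
`…TropicalBSingleGaugeTwoRows` (`chain_le_of_universalGauge_twoRows`: single-gauge chains at `m = 2` have `n ≤ 4K − 8`).  Here the SHARPNESS half
inside the same class: val-sym-trop-p5's DIAMOND design (`…TropicalShiftDiamond*`, `K = a + 3`, every size `m = n + 1`) comes with the row gauge
`u_r(θ) = −κ·r·θ` under which every incidence of every grid term is column-wise optimal (this is exactly `ShiftDiamond.phi_le`: the design's
dominance proof IS a single-gauge certificate), and the gauged slopes `d_l + κ·r` are pairwise distinct.  So:
* `ShiftDiamondGauge.hcert` / `…hgen` — the certificate and its genericity, every `m`, `K ≥ 3`;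
* `exists_singleGauge_chain_twoRows` — **for every `K ≥ 3` there is a format-`(2,K)` design with a dominant sign-alternating chain of
  `n = 4K − 8` breakpoints satisfying all hypotheses of `chain_le_of_universalGauge_twoRows`** — so `4K − 8` is the EXACT single-gauge ceiling on
  two rows (for `K ≥ 4`; at `K = 3` the chain has `4` breakpoints and the ceiling is the census `5`).
Nothing here bears on `TropicalB` in its window, `WeakLifting`, the doors, `MatrixDescartes` (stmt-ValiantsHypothesis-18050) or VP ≠ VNP.  [this seat;
the design, its chain and its dominance are val-sym-trop-p5's (p-ids in `…TropicalShiftDiamondChain`)]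
-/

set_option linter.dupNamespace false
set_option autoImplicit false

namespace Summit.ValiantsHypothesis.ValiantsHypothesis.Theorems.KPlusLogSqLaw

open Summit.ValiantsHypothesis.ValiantsHypothesis.Theorems.MatrixDescartes.Negative
open Summit.ValiantsHypothesis.ValiantsHypothesis.Theorems.LacunarySymmetroidMatrixDescartes.TropicalCensus
open Summit.ValiantsHypothesis.ValiantsHypothesis.Theorems.LacunarySymmetroidMatrixDescartes.TropicalCensus.ShiftDiamond
open Summit.ValiantsHypothesis.ValiantsHypothesis.Theorems.LacunarySymmetroidMatrixDescartes.TropicalCensus.ShiftThree (shiftZ)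
open Summit.ValiantsHypothesis.ValiantsHypothesis.Theorems.LacunarySymmetroidMatrixDescartes.TropicalCensus.ShiftSquare (rot)
open scoped BigOperators
open Finset

namespace SingleGauge

namespace ShiftDiamondGauge

variable (a n : ℕ)

/-- the gauged score is the design score plus the row gauge `κ·r·θ` minus the column constant `κ·b·θ`:
`phi θ r b l = θ·d_l − v + θκ·r − θκ·b`. -/
theorem phi_eq_gauge (θ : ℤ) (r b : Fin (n + 1)) (l : Fin (a + 3)) :
    phi a n θ r b l = θ * (dd a n l : ℤ) - vv a n r b l + θ * (kap a n : ℤ) * (r : ℤ) - θ * (kap a n : ℤ) * (b : ℤ) := by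
  unfold phi shiftZ
  rw [bigD_cast]
  split_ifs with h
  · ring
  · ring

/-- **the certificate**: at every grid slope, every incidence of a column scores at most the grid term's incidence after the gauge
`u_r = −κ·r·θ` (`β = 0`) — the hypothesis `hcert` of `chain_le_of_universalGauge` for DIAMOND's chain. -/
theorem hcert (P s : ℕ) (hP : P ≤ 2 * (n + 1)) (hs : s ≤ a * climb n P) (j i : Fin (n + 1)) (l : Fin (a + 3)) :
    ((th a n P s : ℚ) * (dd a n l : ℚ) - (vv a n i j l : ℚ)) - ((-(kap a n : ℚ) * (i : ℚ)) * (th a n P s : ℚ) + 0) ≤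
      ((th a n P s : ℚ) * (dd a n ((cterm a n P s).2 j) : ℚ) - (vv a n ((cterm a n P s).1 j) j ((cterm a n P s).2 j) : ℚ)) -
        ((-(kap a n : ℚ) * (((cterm a n P s).1 j : Fin (n + 1)) : ℚ)) * (th a n P s : ℚ) + 0) := by
  have h := phi_le a n P s hP hs i j l
  rw [phi_eq_gauge, phi_eq_gauge] at h
  have h' : ((th a n P s * (dd a n l : ℤ) - vv a n i j l + th a n P s * (kap a n : ℤ) * (i : ℤ) : ℤ) : ℚ) ≤
      ((th a n P s * (dd a n ((cterm a n P s).2 j) : ℤ) - vv a n ((cterm a n P s).1 j) j ((cterm a n P s).2 j) +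
        th a n P s * (kap a n : ℤ) * (((cterm a n P s).1 j : Fin (n + 1)) : ℤ) : ℤ) : ℚ) := by
    have : th a n P s * (dd a n l : ℤ) - vv a n i j l + th a n P s * (kap a n : ℤ) * (i : ℤ) ≤
        th a n P s * (dd a n ((cterm a n P s).2 j) : ℤ) - vv a n ((cterm a n P s).1 j) j ((cterm a n P s).2 j) +
          th a n P s * (kap a n : ℤ) * (((cterm a n P s).1 j : Fin (n + 1)) : ℤ) := by
      unfold cterm
      linarith
    exact_mod_cast this
  push_cast at h'
  linarith

/-- **genericity**: the gauged slopes `d_l + κ·r` are pairwise distinct over `(r, l)` (`lo l ≤ a < κ`, `d_l = lo l + hi l·(m κ)`). -/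
theorem hgen (i i' : Fin (n + 1)) (l l' : Fin (a + 3))
    (h : (dd a n l : ℚ) - (-(kap a n : ℚ) * (i : ℚ)) = (dd a n l' : ℚ) - (-(kap a n : ℚ) * (i' : ℚ))) : i = i' ∧ l = l' := by
  have hk : a < kap a n := by
    unfold kap width
    linarith [Nat.zero_le (2 * a * (a * (n + 1) + 1))]
  have h1 : (dd a n l : ℤ) + (kap a n : ℤ) * (i : ℤ) = (dd a n l' : ℤ) + (kap a n : ℤ) * (i' : ℤ) := by
    have : ((dd a n l : ℤ) : ℚ) + (kap a n : ℚ) * (i : ℚ) = ((dd a n l' : ℤ) : ℚ) + (kap a n : ℚ) * (i' : ℚ) := by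
      push_cast; linarith
    exact_mod_cast this
  rw [dd_cast, dd_cast, bigD_cast] at h1
  have hlo := lo_le a l
  have hlo' := lo_le a l'
  -- `lo + κ·X = lo' + κ·X'` with `lo, lo' < κ` forces `X = X'` and `lo = lo'`
  set X : ℤ := (hi a l : ℤ) * ((n : ℤ) + 1) + (i : ℤ) with hX
  set X' : ℤ := (hi a l' : ℤ) * ((n : ℤ) + 1) + (i' : ℤ) with hX'
  have h2 : (lo a l : ℤ) + (kap a n : ℤ) * X = (lo a l' : ℤ) + (kap a n : ℤ) * X' := by rw [hX, hX']; linarith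
  have hXX : X = X' := by
    by_contra hne
    rcases lt_or_gt_of_ne hne with hlt | hgt
    · have : (kap a n : ℤ) * 1 ≤ (kap a n : ℤ) * (X' - X) := mul_le_mul_of_nonneg_left (by omega) (by positivity)
      nlinarith
    · have : (kap a n : ℤ) * 1 ≤ (kap a n : ℤ) * (X - X') := mul_le_mul_of_nonneg_left (by omega) (by positivity)
      nlinarith
  have hlo2 : lo a l = lo a l' := by
    have : (lo a l : ℤ) = lo a l' := by rw [hXX] at h2; linarith
    exact_mod_cast this
  have hi2 : hi a l = hi a l' ∧ i = i' := by
    have hil : (i : ℤ) < (n : ℤ) + 1 := by exact_mod_cast i.isLt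
    have hil' : (i' : ℤ) < (n : ℤ) + 1 := by exact_mod_cast i'.isLt
    have e : (hi a l : ℤ) * ((n : ℤ) + 1) + (i : ℤ) = (hi a l' : ℤ) * ((n : ℤ) + 1) + (i' : ℤ) := by rw [← hX, ← hX', hXX]
    have hh : (hi a l : ℤ) = hi a l' := by
      by_contra hne
      rcases lt_or_gt_of_ne hne with hlt | hgt
      · have : ((n : ℤ) + 1) * 1 ≤ ((n : ℤ) + 1) * ((hi a l' : ℤ) - hi a l) := mul_le_mul_of_nonneg_left (by omega) (by positivity)
        nlinarith
      · have : ((n : ℤ) + 1) * 1 ≤ ((n : ℤ) + 1) * ((hi a l : ℤ) - hi a l') := mul_le_mul_of_nonneg_left (by omega) (by positivity)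
        nlinarith
    refine ⟨by exact_mod_cast hh, ?_⟩
    apply Fin.ext
    have : (i : ℤ) = i' := by rw [hh] at e; linarith
    exact_mod_cast this
  exact ⟨hi2.2, eq_of_digits a hi2.1 hlo2⟩

end ShiftDiamondGauge

namespace TwoRows

/-- **SHARPNESS: the two-row single-gauge ceiling is attained.**  For every `K = a + 3 ≥ 3` the DIAMOND design of format `(2, K)` has a dominant
sign-alternating chain of `n = 4K − 8` breakpoints which satisfies every hypothesis of `chain_le_of_universalGauge_twoRows` (one affine row gauge
`u_r = −κ·r·θ` with pairwise distinct gauged slopes certifies every term column-wise). -/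
theorem exists_singleGauge_chain_twoRows (a : ℕ) :
    ∃ (d : Fin (a + 3) → ℕ) (v ε : Fin 2 → Fin 2 → Fin (a + 3) → ℤ) (α β : Fin 2 → ℚ) (n : ℕ) (θ : Fin (n + 1) → ℤ)
      (p : Fin (n + 1) → Equiv.Perm (Fin 2) × (Fin 2 → Fin (a + 3))),
      n + 8 = 4 * (a + 3) ∧ (∀ i j l, (ε i j l).natAbs ≤ 1) ∧
      (∀ (i i' : Fin 2) (l l' : Fin (a + 3)), (d l : ℚ) - α i = (d l' : ℚ) - α i' → i = i' ∧ l = l') ∧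
      StrictMono θ ∧ (∀ k, IsDominant d v ε (θ k) (p k)) ∧ (∀ k : Fin n, p k.castSucc ≠ p k.succ) ∧
      (∀ (k : Fin (n + 1)) (j i : Fin 2) (l : Fin (a + 3)), ε i j l ≠ 0 →
        ((θ k : ℚ) * (d l : ℚ) - (v i j l : ℚ)) - (α i * (θ k : ℚ) + β i) ≤
          ((θ k : ℚ) * (d ((p k).2 j) : ℚ) - (v ((p k).1 j) j ((p k).2 j) : ℚ)) - (α ((p k).1 j) * (θ k : ℚ) + β ((p k).1 j))) := by
  refine ⟨dd a 1, vv a 1, ee a 1, fun r => -(kap a 1 : ℚ) * (r : ℚ), fun _ => 0, st a 1 (2 * (1 + 1)),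
    fun k => th a 1 (grid a 1 k).1 (grid a 1 k).2, fun k => cterm a 1 (grid a 1 k).1 (grid a 1 k).2, ?_, ?_, ?_, ?_, ?_, ?_, ?_⟩
  · rw [st_top]; ring
  · exact fun r b l => (ee_natAbs a 1 r b l).le
  · exact ShiftDiamondGauge.hgen a 1
  · refine Fin.strictMono_iff_lt_succ.mpr fun k => ?_
    simp only [Fin.val_castSucc, Fin.val_succ]
    exact th_grid_lt a 1 k (by omega)
  · intro k
    obtain ⟨_, h2, h3⟩ := grid_inv a 1 k (by omega)
    exact isDominant_cterm a 1 _ _ h3 h2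
  · intro k heq
    simp only at heq
    have hsg : termSign (ee a 1) (cterm a 1 (grid a 1 (k.castSucc : ℕ)).1 (grid a 1 (k.castSucc : ℕ)).2) *
        termSign (ee a 1) (cterm a 1 (grid a 1 (k.succ : ℕ)).1 (grid a 1 (k.succ : ℕ)).2) < 0 := by
      simp only [Fin.val_castSucc, Fin.val_succ]
      rw [termSign_grid a 1 k (by omega), termSign_grid a 1 (k + 1) (by omega), ← pow_add,
        show (k : ℕ) + (k + 1) = 2 * k + 1 by ring, pow_succ, pow_mul]
      norm_num
    rw [heq] at hsg
    exact absurd hsg (not_lt.2 (mul_self_nonneg _))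
  · intro k j i l _
    obtain ⟨_, h2, h3⟩ := grid_inv a 1 k (by omega)
    exact ShiftDiamondGauge.hcert a 1 _ _ h3 h2 j i l

end TwoRows

end SingleGauge

end Summit.ValiantsHypothesis.ValiantsHypothesis.Theorems.KPlusLogSqLaw
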